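import Summits.Parity.BatemanHorn.Theses.AlmostPrimeZeros
import Summits.Parity.BatemanHorn.Theorems.SystemLSDRealSegment.Negative.Structure
import Summits.Parity.BatemanHorn.Theorems.AlmostPrimeZerosSystemLSDRealSegmentReductionCore
import Summits.Parity.BatemanHorn.Theorems.AlmostPrimeZerosSystemLSDRealSegmentEulerFactor
import HarnessLib

/-!
# `SystemLSDRealSegment` (stmt-Parity-11292), line `beta-thinned-root-kernel`: the reduction to the kernel law

With the six registered stubs of the checked skeleton `Cruxes/SystemLSDRealSegment/Lines/beta-thinned-root-kernel.lean`
now theorems of the tree and composed in `…ReductionCore.lean` (`typeILaw_holds`, `betaKernelLaw_iff_segmentLaw`, the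
exact expansion and split), this file adds what needs the Euler-factor module:

* `eulerFactorClause_holds` — for every Bateman–Horn system, `λ_f = eulerFactor f` is holomorphic on `|z| < 2` and
  `λ_f(0) = C(f)` (the route header's "NOT DECOMPOSED YET (i)", composition of `stub_eulerFactor`, `stub_congruenceFacts`);
* `systemLSDRealSegment_of_betaKernelLaw` (registered name) — the crux `SystemLSDRealSegment` follows from the kernel law
  `BetaKernelLaw` on the segment ALONE, with `Λ := eulerFactor f`;
* `eulerFactor_unique` — any `Λ` witnessing the crux for `f` coincides with `λ_f` on the ball (landed `Negative.Λ_unique`).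

So the crux's remaining content is exactly ONE positive equidistribution statement (the registered open stub
`stub_betaKernel`): thinned divisor tuples of the values beyond level `x`, with the forced constant
`λ_f(y)(D^{y−1}Γ(y)^{−k} − Γ(k(y−1)+1)^{−1})`.
-/

open Filter Finset Polynomial
open scoped BigOperators Topology

namespace Summit.Parity.BatemanHorn.Cruxes.SystemLSDRealSegment.BetaThinnedRootKernel

open Literature.NumberTheory.Sieve
open Summit.Parity.BatemanHorn.Theses.AlmostPrimeZeros (SystemLSDRealSegment)

noncomputable section

/-- `EulerFactorClause k f` for every family: for a Bateman–Horn system `f`, `λ_f = eulerFactor f` is holomorphic on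
`|z| < 2` and `λ_f(0) = batemanHornConst f` (composition of the landed `stub_eulerFactor` and `stub_congruenceFacts`).
[folklore] -/
theorem eulerFactorClause_holds : ∀ (k : ℕ) (f : Fin k → ℤ[X]), EulerFactorClause k f :=
  stub_eulerFactor stub_congruenceFacts.2

/-- **THE REDUCTION** (registered helper of the crux): the kernel law `BetaKernelLaw` on the segment implies the crux
`SystemLSDRealSegment`, with `Λ := eulerFactor f` — holomorphy and `Λ(0) = C(f)` are `eulerFactorClause_holds`, the
segment law is `segmentLaw_of_betaKernelLaw`.  What remains of stmt-Parity-11292 is exactly the open stub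
`stub_betaKernel`. [folklore] -/
theorem systemLSDRealSegment_of_betaKernelLaw :
    (∀ (k : ℕ) (f : Fin k → ℤ[X]), IsBatemanHornSystem f → ∀ y : ℝ, 5 / 4 < y → y < 7 / 4 →
      BetaKernelLaw k f y) → SystemLSDRealSegment := fun hK k f hf =>
  ⟨eulerFactor f, (eulerFactorClause_holds k f hf).1, (eulerFactorClause_holds k f hf).2,
    fun y hy hy' => segmentLaw_of_betaKernelLaw hK hf y hy hy'⟩

/-- **Uniqueness**: ANY `Λ` holomorphic on `|z| < 2` satisfying the crux's segment law for a Bateman–Horn system `f`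
coincides with `eulerFactor f` on the ball, PROVIDED the kernel law holds for `f` (landed `Negative.Structure.Λ_unique`).
In particular the `∃ Λ` of the crux has no slack: the line produces the `Λ` the identity theorem pins. [folklore] -/
theorem eulerFactor_unique {k : ℕ} {f : Fin k → ℤ[X]} (hf : IsBatemanHornSystem f)
    (hK : ∀ y : ℝ, 5 / 4 < y → y < 7 / 4 → BetaKernelLaw k f y)
    {Λ : ℂ → ℂ} (hΛ : DifferentiableOn ℂ Λ (Metric.ball 0 2))
    (hlaw : ∀ y : ℝ, 5 / 4 < y → y < 7 / 4 →
      Tendsto (fun x : ℕ => (x : ℂ)⁻¹ * Complex.exp ((k : ℂ) * (1 - (y : ℂ)) * (Real.log (Real.log x) : ℂ)) *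
          ∑ n ∈ range (x + 1), (y : ℂ) ^ (∑ i, (((f i).eval (n : ℤ)).toNat.factorization.sum fun _ v => min v 2)))
        atTop
        (𝓝 (Λ y * Complex.exp (((y : ℂ) - 1) * (Real.log (∏ i, ((f i).natDegree : ℝ)) : ℂ)) *
          (Complex.Gamma y)⁻¹ ^ k))) :
    Set.EqOn Λ (eulerFactor f) (Metric.ball 0 2) := by
  refine Summit.Parity.BatemanHorn.Theorems.SystemLSDRealSegment.Negative.Λ_unique (k := k) (f := f) hΛ
    (eulerFactorClause_holds k f hf).1 (fun y hy hy' => ?_) (fun y hy hy' => ?_)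
  · simpa only [mul_assoc] using hlaw y hy hy'
  · simpa only [mul_assoc] using
      (betaKernelLaw_iff_segmentLaw hf (by linarith : (1 : ℝ) < y)).1 (hK y hy hy')

end

end Summit.Parity.BatemanHorn.Cruxes.SystemLSDRealSegment.BetaThinnedRootKernel
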